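import Mathlib
import Literature.NumberTheory.Transcendental.KZCalculus
import Literature.NumberTheory.Transcendental.KZProduct
import Literature.NumberTheory.Transcendental.KZProductIdeal
import Literature.NumberTheory.Transcendental.KZBallPeeling
import Literature.NumberTheory.Transcendental.KZSemialgebraicComplex
import Literature.NumberTheory.Transcendental.KZRulesAssociator
import Literature.NumberTheory.Transcendental.KZRelationsLE
import Literature.NumberTheory.Transcendental.SemialgebraicMapsProofs
import Summits.KontsevichZagierPeriods.KontsevichZagierPeriods.Theses.TorsionLogs

/-!
# Route TorsionLogs — support item `GKZLevelThreePair`: the right-hand side in normal form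

Item `stmt-KontsevichZagierPeriods-13812` (route decl
`Summit.KontsevichZagierPeriods.KontsevichZagierPeriods.Theses.TorsionLogs.GKZLevelThreePair`)
asks for the Kontsevich–Zagier equivalence of the 3-dimensional Euler integral

  `J₃ = ∫_{(0,1)³} ∏_{u ∈ {x₀,x₁}} u^{-1/3}(1-u)^{-2/3}(1-(1-x₂)u/2)^{-1/3}`   (value `4√3 · π · log 2`)

with the representation `r' = [{(x₀²+x₁²)² < 48, 1 < x₂ < 2}, 1/x₂]` of the same number
(`area · log 2 = π√48 · log 2`).

This file settles the bookkeeping half of the item (helpers `--supports` it; the item itself stays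
open):

* `gkzLevelThree_prod_equivalent_rhs` — **the right-hand side is a product in normal form**: for
  every representation `r'` pinned as in the item, every `D = [unit open disc, 1]` and every
  `L = [(1,2), √48/t]`, `D × L ∼ r'` by ONE change of variables (Kontsevich–Zagier rule 2)) along
  the diagonal dilation `(z₀,z₁,z₂) ↦ (ρ z₀, ρ z₁, z₂)`, `ρ = ⁴√48 = √(√48)` (real algebraic),
  Jacobian `ρ² = √48`;
* `exists_intervalRep_sqrt48_div` — the factor `L` exists;
* `gkzLevelThreePair_of_core` — **reduction**: `GKZLevelThreePair` follows from the CORE statement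
  that every Euler representation `r` of the item is equivalent to `D × L` (`D`, `L` pinned as
  above), i.e. from `⟦r⟧ = ⟦D⟧ · ⟦L⟧` in the formal period ring (`core_iff_toFormalPeriod`).

The core is where the mathematics of the item lives (Zhou 2015, Remark 9: `J₃ = (2π/√3)² ∫₀¹
P_{-1/3}(ξ)² dξ` and `∫₀¹ P_{-1/3}² = 3√3 log 2/π`, proved in the tree as a VALUE identity,
`Literature.NumberTheory.Automorphic.LegendreP.KZ_value_level_three`); no chain of moves for it is
in print. The prover's blueprint (item evidence `blueprint-13812.md`) reduces it to two explicit
transformation steps (Clausen's formula and Euler ↔ Mehler–Dirichlet at `ν = -1/3`, where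
`B(2/3,1/3)/π = 2/√3` is algebraic) plus explicit Stokes descents.

## References

* M. Kontsevich, D. Zagier, *Periods* (2001), §1.1–1.2 (rules 1)–3); `log 2 = ∫₁² dx/x`,
  `π = ∬_{x²+y²<1} dx dy`).
* Y. Zhou, *Kontsevich–Zagier integrals for automorphic Green's functions. I*, Ramanujan J. 38
  (2015), Remark 9.
-/

-- `Summit.<Summit>.<Sub>` with Sub = Summit (single-conjunct summit, D-0017) duplicates the segment.
set_option linter.dupNamespace false

noncomputable section

namespace Summit.KontsevichZagierPeriods.KontsevichZagierPeriods.Theorems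

open Set MeasureTheory
open MvPolynomial (aeval X C)
open Literature.NumberTheory.Transcendental Literature.NumberTheory.Transcendental.KZ
open Literature.ModelTheory.ExponentialFields (IsSemialgebraic isSemialgebraic_setOf_eval_pos)

/-! ## The dilation constant `ρ = ⁴√48` -/

/-- `ρ = √(√48)` is positive. -/
private lemma rho_pos : 0 < Real.sqrt (Real.sqrt 48) :=
  Real.sqrt_pos.mpr (Real.sqrt_pos.mpr (by norm_num))

/-- `ρ² = √48`. -/
private lemma rho_sq : Real.sqrt (Real.sqrt 48) ^ 2 = Real.sqrt 48 :=
  Real.sq_sqrt (Real.sqrt_nonneg _)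

/-- `ρ⁴ = 48`. -/
private lemma rho_pow_four : Real.sqrt (Real.sqrt 48) ^ 4 = 48 := by
  rw [show (4 : ℕ) = 2 * 2 by norm_num, pow_mul, rho_sq, Real.sq_sqrt (by norm_num)]

/-- `ρ = ⁴√48` is algebraic over `ℚ` (a root of `X⁴ − 48`). -/
private lemma isAlgebraic_rho : IsAlgebraic ℚ (Real.sqrt (Real.sqrt 48)) := by
  refine ⟨Polynomial.X ^ 4 - Polynomial.C (48 : ℚ), ?_, ?_⟩
  · exact Polynomial.X_pow_sub_C_ne_zero (by norm_num) _
  · simp only [map_sub, map_pow, Polynomial.aeval_X, Polynomial.aeval_C, rho_pow_four]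
    simp

/-- `√48` is algebraic over `ℚ` (a root of `X² − 48`). -/
private lemma isAlgebraic_sqrt48 : IsAlgebraic ℚ (Real.sqrt 48) := by
  refine ⟨Polynomial.X ^ 2 - Polynomial.C (48 : ℚ), ?_, ?_⟩
  · exact Polynomial.X_pow_sub_C_ne_zero (by norm_num) _
  · simp only [map_sub, map_pow, Polynomial.aeval_X, Polynomial.aeval_C,
      Real.sq_sqrt (show (0:ℝ) ≤ 48 by norm_num)]
    simp

/-- `x₀² + x₁² < √48 ↔ (x₀² + x₁²)² < 48` for the (nonnegative) sum of two squares. -/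
private lemma sum_sq_lt_sqrt48_iff (a b : ℝ) :
    a ^ 2 + b ^ 2 < Real.sqrt 48 ↔ (a ^ 2 + b ^ 2) ^ 2 < 48 := by
  have h0 : 0 ≤ a ^ 2 + b ^ 2 := by positivity
  exact Real.lt_sqrt h0

/-! ## The interval factor `L = [(1,2), √48/t]` exists -/

/-- The interval `{t | 1 < t₀ < 2} ⊆ ℝ¹` is `ℚ`-semialgebraic. -/
private lemma isSemialgebraic_Ioo12 :
    IsSemialgebraic ℚ {t : Fin 1 → ℝ | t 0 ∈ Set.Ioo (1:ℝ) 2} := by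
  convert (isSemialgebraic_setOf_eval_pos (k := ℚ) (R := ℝ)
      (X (0 : Fin 1) - C (1 : ℚ) : MvPolynomial (Fin 1) ℚ)).inter
    (isSemialgebraic_setOf_eval_pos (k := ℚ) (R := ℝ)
      (C (2 : ℚ) - X (0 : Fin 1) : MvPolynomial (Fin 1) ℚ)) using 1
  ext t
  simp [sub_pos]

/-- **The factor `L` exists**: a representation with domain `{1 < t₀ < 2}` and integrand `√48/t₀`
on it (`√48 · [(1,2), 1/t]`, value `√48 log 2`). [Kontsevich–Zagier 2001, §1.1: `log 2 = ∫₁² dx/x`] -/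
theorem exists_intervalRep_sqrt48_div :
    ∃ L : IntegralRep 1, L.domain = {t | t 0 ∈ Set.Ioo (1:ℝ) 2} ∧
      EqOn L.integrand (fun t => Real.sqrt 48 / t 0) L.domain := by
  set σ : Set (Fin 1 → ℝ) := {t | t 0 ∈ Set.Ioo (1:ℝ) 2} with hσ
  have hq : ∀ x ∈ σ, aeval x (X (0 : Fin 1) : MvPolynomial (Fin 1) ℚ) ≠ 0 := by
    intro x hx
    have hx1 : (1:ℝ) < x 0 := hx.1
    simp only [MvPolynomial.aeval_X, ne_eq]
    exact ne_of_gt (by linarith)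
  have hK : IsCompact (Set.pi univ fun _ : Fin 1 => Set.Icc (1:ℝ) 2) :=
    isCompact_univ_pi fun _ => isCompact_Icc
  have hcont : ContinuousOn (fun x : Fin 1 → ℝ => 1 / x 0)
      (Set.pi univ fun _ : Fin 1 => Set.Icc (1:ℝ) 2) := by
    refine continuousOn_const.div (continuous_apply 0).continuousOn fun x hx => ?_
    have h1 : (1:ℝ) ≤ x 0 := ((mem_univ_pi.mp hx) 0).1
    exact ne_of_gt (by linarith)
  have hint : IntegrableOn
      (fun x => aeval x (1 : MvPolynomial (Fin 1) ℚ) / aeval x (X (0 : Fin 1) : MvPolynomial (Fin 1) ℚ))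
      σ := by
    have h : (fun x : Fin 1 → ℝ => aeval x (1 : MvPolynomial (Fin 1) ℚ) /
        aeval x (X (0 : Fin 1) : MvPolynomial (Fin 1) ℚ)) = fun x => 1 / x 0 := by
      ext x; simp
    rw [h]
    refine (hcont.integrableOn_compact hK).mono_set fun x hx => ?_
    simp only [mem_univ_pi, mem_Icc]
    intro i
    have hi : i = 0 := Subsingleton.elim i 0
    subst hi
    exact ⟨hx.1.le, hx.2.le⟩
  let L₁ : IntegralRep 1 := IntegralRep.ofRational σ 1 (X 0) isSemialgebraic_Ioo12 hq hint
  refine ⟨L₁.constMul (Real.sqrt 48) isAlgebraic_sqrt48, rfl, fun t _ => ?_⟩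
  simp [L₁, div_eq_mul_inv]

/-! ## The right-hand side as a product: one change of variables -/

/-- **The right-hand side of `GKZLevelThreePair` is `[disc] × [(1,2), √48/t]`.** For `r'` pinned
as in the item (domain `{(x₀²+x₁²)² < 48 ∧ 1 < x₂ < 2}`, integrand `1/x₂` on it),
`D = [{w₀²+w₁² < 1}, 1]` and `L = [{1 < t < 2}, √48/t]`, the product representation `D × L` and
`r'` differ by ONE instance of Kontsevich–Zagier's rule 2): the linear substitution
`Φ(z) = (ρ z₀, ρ z₁, z₂)`, `ρ = ⁴√48`, maps `disc × (1,2)` onto `r'.domain`, is `ℚ`-semialgebraic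
(algebraic diagonal matrix), injective, its own derivative, with `|det Φ'| = ρ² = √48`, and
`(1 · √48/z₂) = (1/z₂) · √48`. [Kontsevich–Zagier 2001, §1.2, rule 2)] -/
theorem gkzLevelThree_prod_equivalent_rhs (r' : IntegralRep 3)
    (hr'd : r'.domain = {x | (x 0 ^ 2 + x 1 ^ 2) ^ 2 < 48 ∧ x 2 ∈ Set.Ioo (1:ℝ) 2})
    (hr'i : EqOn r'.integrand (fun x => 1 / x 2) r'.domain)
    (D : IntegralRep 2) (hDd : D.domain = {w | ∑ i, (w i) ^ 2 < 1})
    (hDi : EqOn D.integrand (fun _ => 1) D.domain)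
    (L : IntegralRep 1) (hLd : L.domain = {t | t 0 ∈ Set.Ioo (1:ℝ) 2})
    (hLi : EqOn L.integrand (fun t => Real.sqrt 48 / t 0) L.domain) :
    Equivalent (D.prod L) r' := by
  -- the dilation
  set ρ : ℝ := Real.sqrt (Real.sqrt 48) with hρ
  have hρ0 : 0 < ρ := rho_pos
  have hρne : ρ ≠ 0 := hρ0.ne'
  let d : Fin 3 → ℝ := ![ρ, ρ, 1]
  have hd0 : d 0 = ρ := rfl
  have hd1 : d 1 = ρ := rfl
  have hd2 : d 2 = 1 := rfl
  have hdne : ∀ i, d i ≠ 0 := by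
    intro i
    fin_cases i
    · exact hρne
    · exact hρne
    · exact one_ne_zero
  have hdalg : ∀ i, IsAlgebraic ℚ (d i) := by
    intro i
    fin_cases i
    · exact isAlgebraic_rho
    · exact isAlgebraic_rho
    · simpa [d] using isAlgebraic_one
  let Φ' : (Fin 3 → ℝ) →L[ℝ] (Fin 3 → ℝ) :=
    LinearMap.toContinuousLinearMap (Matrix.toLin' (Matrix.diagonal d))
  let Φ : (Fin 3 → ℝ) → (Fin 3 → ℝ) := Φ'
  have hΦ : ∀ z i, Φ z i = d i * z i := by
    intro z i
    show (Matrix.toLin' (Matrix.diagonal d)) z i = d i * z i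
    rw [Matrix.toLin'_apply, Matrix.mulVec_diagonal]
  have hdet : Φ'.det = Real.sqrt 48 := by
    show LinearMap.det ((Φ' : (Fin 3 → ℝ) →L[ℝ] (Fin 3 → ℝ)) : (Fin 3 → ℝ) →ₗ[ℝ] (Fin 3 → ℝ)) = _
    have : ((Φ' : (Fin 3 → ℝ) →L[ℝ] (Fin 3 → ℝ)) : (Fin 3 → ℝ) →ₗ[ℝ] (Fin 3 → ℝ)) =
        Matrix.toLin' (Matrix.diagonal d) := rfl
    rw [this, LinearMap.det_toLin', Matrix.det_diagonal, Fin.prod_univ_three, hd0, hd1, hd2,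
      mul_one, ← sq, rho_sq]
  -- indices of the product decomposition `Fin 3 = Fin 2 + Fin 1`
  have hc0 : (Fin.castAdd 1 (0 : Fin 2) : Fin 3) = 0 := rfl
  have hc1 : (Fin.castAdd 1 (1 : Fin 2) : Fin 3) = 1 := rfl
  have hn0 : (Fin.natAdd 2 (0 : Fin 1) : Fin 3) = 2 := rfl
  -- membership in the product domain
  have hmem : ∀ z : Fin 3 → ℝ, z ∈ (D.prod L).domain ↔
      z 0 ^ 2 + z 1 ^ 2 < 1 ∧ z 2 ∈ Set.Ioo (1:ℝ) 2 := by
    intro z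
    simp only [IntegralRep.prod_domain, IntegralRep.prodDomain, mem_setOf_eq, hDd, hLd,
      Fin.sum_univ_two, hc0, hc1, hn0]
  -- (i) semialgebraic map
  have hsa : IsSemialgebraic ℚ (D.prod L).domain := (D.prod L).isSemialgebraic_domain
  have hmap : IsSemialgebraicMapOn ℚ (D.prod L).domain Φ := by
    refine IsSemialgebraicMapOn.of_forall hsa fun j => ?_
    have h1 : IsSemialgebraicFunOn ℚ (D.prod L).domain (fun _ => d j) :=
      isSemialgebraicFunOn_const_of_isAlgebraic hsa (hdalg j)
    have h2 : IsSemialgebraicFunOn ℚ (D.prod L).domain (fun z => z j) :=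
      (isSemialgebraicFunOn_aeval hsa (X j : MvPolynomial (Fin 3) ℚ)).congr fun z _ => by simp
    exact (IsSemialgebraicFunOn.mul_holds h1 h2).congr fun z _ => by simp [hΦ]
  -- (ii) derivative
  have hderiv : ∀ z ∈ (D.prod L).domain, HasFDerivWithinAt Φ (Φ' ) (D.prod L).domain z :=
    fun z _ => Φ'.hasFDerivWithinAt
  -- (iii) injectivity
  have hinj : InjOn Φ (D.prod L).domain := by
    intro z _ w _ hzw
    ext i
    have hi := congr_fun hzw i
    rw [hΦ, hΦ] at hi
    exact mul_left_cancel₀ (hdne i) hi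
  -- (iv) the image of the domain
  have hdom : r'.domain = Φ '' (D.prod L).domain := by
    rw [hr'd]
    ext x
    simp only [mem_setOf_eq, mem_image]
    constructor
    · rintro ⟨hx, hx2⟩
      refine ⟨fun i => x i / d i, ?_, ?_⟩
      · rw [hmem]
        refine ⟨?_, by simpa [hd2] using hx2⟩
        rw [hd0, hd1, div_pow, div_pow, rho_sq, ← add_div, div_lt_one (Real.sqrt_pos.mpr
          (by norm_num)), sum_sq_lt_sqrt48_iff]
        exact hx
      · ext i
        rw [hΦ, mul_div_cancel₀ _ (hdne i)]
    · rintro ⟨z, hz, rfl⟩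
      rw [hmem] at hz
      obtain ⟨hz, hz2⟩ := hz
      refine ⟨?_, by simpa [hΦ, hd2] using hz2⟩
      rw [hΦ, hΦ, hd0, hd1, ← sum_sq_lt_sqrt48_iff, mul_pow, mul_pow, rho_sq, ← mul_add]
      calc Real.sqrt 48 * (z 0 ^ 2 + z 1 ^ 2) < Real.sqrt 48 * 1 :=
            mul_lt_mul_of_pos_left hz (Real.sqrt_pos.mpr (by norm_num))
        _ = Real.sqrt 48 := mul_one _
  -- (v) the integrands
  have hint : ∀ z ∈ (D.prod L).domain,
      (D.prod L).integrand z = r'.integrand (Φ z) * |(Φ').det| := by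
    intro z hz
    have hz' := (hmem z).mp hz
    have hΦz : Φ z ∈ r'.domain := hdom ▸ mem_image_of_mem Φ hz
    have hzD : (fun i : Fin 2 => z (Fin.castAdd 1 i)) ∈ D.domain := hz.1
    have hzL : (fun j : Fin 1 => z (Fin.natAdd 2 j)) ∈ L.domain := hz.2
    rw [IntegralRep.prod_integrand_eq, IntegralRep.prodFun_apply, hDi hzD, hLi hzL, hr'i hΦz,
      hdet, abs_of_nonneg (Real.sqrt_nonneg _)]
    simp only [hn0, hΦ, hd2, one_mul]
    ring
  have hcov : of (D.prod L) - of r' ∈ changeOfVariablesRel :=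
    ⟨3, D.prod L, r', Φ, fun _ => Φ', hmap, hderiv, hinj, hdom, hint, rfl⟩
  exact changeOfVariablesRel_subset_relations hcov

/-- The same, read in the formal period ring `P = FormalRep ⧸ relations`:
`⟦r'⟧ = ⟦D⟧ · ⟦L⟧`. [Kontsevich–Zagier 2001, §1.2, rule 2); §4.1 (Fubini product)] -/
theorem gkzLevelThree_toFormalPeriod_rhs (r' : IntegralRep 3)
    (hr'd : r'.domain = {x | (x 0 ^ 2 + x 1 ^ 2) ^ 2 < 48 ∧ x 2 ∈ Set.Ioo (1:ℝ) 2})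
    (hr'i : EqOn r'.integrand (fun x => 1 / x 2) r'.domain)
    (D : IntegralRep 2) (hDd : D.domain = {w | ∑ i, (w i) ^ 2 < 1})
    (hDi : EqOn D.integrand (fun _ => 1) D.domain)
    (L : IntegralRep 1) (hLd : L.domain = {t | t 0 ∈ Set.Ioo (1:ℝ) 2})
    (hLi : EqOn L.integrand (fun t => Real.sqrt 48 / t 0) L.domain) :
    toFormalPeriod (of r') = toFormalPeriod (of D) * toFormalPeriod (of L) := by
  rw [toFormalPeriod_of_mul_of]
  exact ((gkzLevelThree_prod_equivalent_rhs r' hr'd hr'i D hDd hDi L hLd hLi).symm).toFormalPeriod_eq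

/-! ## Reduction of the item to its core -/

/-- **Reduction of `GKZLevelThreePair` to its core.** If every Euler representation `r` of the item
(domain the open unit cube, integrand the level-3 Euler kernel on it) is KZ-equivalent to the
product `D × L` of the unit-disc representation `D = [{w₀²+w₁² < 1}, 1]` (value `π`) and the
interval representation `L = [{1 < t < 2}, √48/t]` (value `4√3 log 2`) — the CORE of the item, an
explicit chain of moves realising Zhou's value identity `J₃ = 4√3 π log 2` (Zhou 2015, Remark 9)
— then `GKZLevelThreePair` holds: compose with `gkzLevelThree_prod_equivalent_rhs`.
[Kontsevich–Zagier 2001, §1.2; Zhou 2015, Remark 9] -/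
theorem gkzLevelThreePair_of_core
    (hcore : ∀ (r : IntegralRep 3), r.domain = {x | ∀ i, x i ∈ Set.Ioo (0:ℝ) 1} →
      EqOn r.integrand (fun x => (x 0) ^ (-(1:ℝ) / 3) * (1 - x 0) ^ (-(2:ℝ) / 3) *
        (1 - (1 - x 2) * x 0 / 2) ^ (-(1:ℝ) / 3) * ((x 1) ^ (-(1:ℝ) / 3) * (1 - x 1) ^ (-(2:ℝ) / 3) *
        (1 - (1 - x 2) * x 1 / 2) ^ (-(1:ℝ) / 3))) r.domain →
      ∀ (D : IntegralRep 2) (L : IntegralRep 1), D.domain = {w | ∑ i, (w i) ^ 2 < 1} →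
        EqOn D.integrand (fun _ => 1) D.domain → L.domain = {t | t 0 ∈ Set.Ioo (1:ℝ) 2} →
        EqOn L.integrand (fun t => Real.sqrt 48 / t 0) L.domain → Equivalent r (D.prod L)) :
    Summit.KontsevichZagierPeriods.KontsevichZagierPeriods.Theses.TorsionLogs.GKZLevelThreePair := by
  intro r r' hrd hri hr'd hr'i
  obtain ⟨D, hDd, hDi⟩ := BallPeeling.exists_ballRep 2 0
  obtain ⟨L, hLd, hLi⟩ := exists_intervalRep_sqrt48_div
  have hDi' : EqOn D.integrand (fun _ => 1) D.domain := fun w _ => by simp [hDi]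
  exact (hcore r hrd hri D L hDd hDi' hLd hLi).trans
    (gkzLevelThree_prod_equivalent_rhs r' hr'd hr'i D hDd hDi' L hLd hLi)

/-- **The core, read in the formal period ring.** For pinned `r`, `D`, `L` as above,
`r ∼ D × L ↔ ⟦r⟧ = ⟦D⟧ · ⟦L⟧`. [Kontsevich–Zagier 2001, §4.1] -/
theorem core_iff_toFormalPeriod (r : IntegralRep 3) (D : IntegralRep 2) (L : IntegralRep 1) :
    Equivalent r (D.prod L) ↔ toFormalPeriod (of r) = toFormalPeriod (of D) * toFormalPeriod (of L) := by
  rw [toFormalPeriod_of_mul_of, toFormalPeriod_eq_iff]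
  rfl

end Summit.KontsevichZagierPeriods.KontsevichZagierPeriods.Theorems

end
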